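import Literature.AlgebraicGeometry.HodgeTheory.PolarizedLimitMixedHodgeStructureHodgeClassLimit
import HarnessLib

/-!
# Real classes of low weight along a nilpotent orbit vanish; `N`-invariant classes are Hodge at every point
# (the exact-case weight arguments behind Cattani–Deligne–Kaplan, Thm. 2.5, Lemma 4.5 (i) and Prop. 4.8, `n = 1`)

Topic `Literature/AlgebraicGeometry/HodgeTheory` (namespaces `…Motives.MixedHodgeStructure` and
`…HodgeTheory.PolarizedLimitMixedHodgeStructure`).  Theorems only; no definition, no instance, no named fact (D-0026 net debt `0`).

PRINTED SOURCE, VERBATIM. E. Cattani, P. Deligne, A. Kaplan, *On the locus of Hodge classes*, J. Amer. Math. Soc. 8 (1995),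
proof of **Lemma 4.5 (i)** (p. 502): «Any limiting value of the ray spanned by the real vector `e(τ(n))u(n)` is hence in
`W¹_{w+l₁} ∩ F_♯⁰ ∩ F̄_♯⁰`. As `(W¹[w], F_♯)` is a mixed Hodge structure, this intersection can be nonzero only for `w + l₁ ≥ 0`.»;
proof of **Prop. 4.8** (p. 505): «By 4.7, `T₁u(n)` is in `W¹₋₃`. It is also the sum of `X` in `Φ⁻¹(z(n))` and of an exponentially
small `ε` … the `e(τ(n))Φ(z(n))` belong to a compact family of filtrations `F̃`, for which `W¹₋₃ ∩ F̃⁻¹ ∩ \bar F̃⁻¹ = 0`, so that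
`e(τ(n))T₁u(n)` must be exponentially small.»; **4.9** (p. 505): «Taking a subsequence … we find that `u` is in the corresponding
`Φ⁰`. It is in `W₀` by 4.3.»  (Weight `0`, type `(0, 0)`; here weight `k`, type `(p, k − p)`.)

THE MECHANISM (for EXACT Hodge classes the «exponentially small» terms are zero and no compactness is needed): for ANY mixed
Hodge structure `(W, F)` and a REAL vector `x ∈ W_{m,ℂ} ∩ F^a` with `2a > m`, the class of `x` in the pure `Gr^W_m` lies in
`F^a ∩ conj F^a = 0` (weight `m < 2a`), so `x ∈ W_{m−1,ℂ}`; descending, **`x = 0`** (§1; the rational case `x = 1 ⊗ v` is the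
tree's `MixedHodgeStructure.eq_zero_of_mem_W_of_lt`).  Along the one-variable nilpotent orbit `θ(z) = exp(zN)·F` of a polarized
limit mixed Hodge structure `L` of weight `k`, `(W, θ(z))` is a mixed Hodge structure for EVERY `z` (the tree's `L.expTwist z`;
`Gr^W θ(z) = Gr^W F`), whence (§2):
* a real `x ∈ W_{k−1,ℂ}` of type `(p, k−p)` at `θ(z)` vanishes (`eq_zero_of_conj_eq_of_mem_baseChange_W_pred_of_mem_nilpotentOrbit_piece`) —
  CDK 4.5 (i)/4.3 at `d = 1`: a real Hodge class at `θ(z)` of weight `≤ k` has NONZERO image in `Gr^W_k` unless it is `0`;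
* if `N x ∈ W_{k−3,ℂ}` for such an `x`, then **`N x = 0`** (`N x` is real, of type `(p−1, k−p−1)`-filtration level at `θ(z)`, and of
  weight `≤ k − 3 < 2(p − 1)`): CDK Prop. 4.8 at `d = 1`, exact case (`N_apply_eq_zero_of_…_of_N_apply_mem_baseChange_W`);
* `N x ∈ W_{k−3,ℂ}` as soon as `x ∈ W_{k,ℂ}` and the top component `π̂_k x` of the `δ`-grading is killed by `N` (CDK Prop. 4.7
  supplies exactly this: `N_apply_mem_baseChange_W_sub_three_of_N_deligneEProj_eq_zero`);
* (§3) an `N`-INVARIANT vector is of type `(p, q)` at one point of the orbit iff at every point iff `x ∈ F^p ∩ conj F^q` for the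
  LIMIT filtration (`exp(zN) x = x`): `mem_nilpotentOrbit_F_iff_of_N_apply_eq_zero`, `mem_nilpotentOrbit_piece_iff_of_N_apply_eq_zero`,
  and then `x ∈ I^{p,q}` of the limit mixed Hodge structure (`mem_deligneI_of_N_apply_eq_zero_of_mem_nilpotentOrbit_piece`) —
  CDK 4.9 «`u` is in the corresponding `Φ⁰`» for all points at once;
* (§4) the package used by the integral theorem: a real `x ∈ W_{k,ℂ}` of type `(p, k−p)` at some `θ(z)` whose top component
  `π̂_k x` is `N`-invariant satisfies `N x = 0`, is of type `(p, k−p)` at every point of the orbit, and lies in `I^{p,k−p}`.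

NOT HERE: the compactness step (CDK Prop. 4.7: why `π̂_k x` is `N`-invariant for Hodge classes of bounded norm near the puncture)
and the lattice/finiteness statements — sequel files of this story.

## References

* [CattaniDeligneKaplan1995] E. Cattani, P. Deligne, A. Kaplan, *On the locus of Hodge classes*, J. Amer. Math. Soc. 8 (1995)
  483–506: Thm. 2.5 (p. 488), Lemma 4.5 (i) (p. 502), Prop. 4.7, Prop. 4.8, 4.9 (pp. 503–505).
* [DeligneHodgeII1971] P. Deligne, *Théorie de Hodge II*, Publ. Math. IHÉS 40 (1971): 2.3.1, Thm. 2.3.5.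
* [CattaniElZeinGriffithsLe2014] E. Cattani et al. (eds.), *Hodge Theory*, Math. Notes 49 (2014): Def. 3.2.15, §7.5 (7.5.8),
  Example 7.5.2, Thm. 7.5.11 (3).
* [Schmid1973] W. Schmid, Invent. Math. 22 (1973): Thm. (6.16) (cite only).
-/

noncomputable section

open scoped TensorProduct

namespace Literature.AlgebraicGeometry

open Module
open Motives Motives.MixedHodgeStructure
open Motives.HodgeStructure (conj conj_conj complexConj mem_complexConj conj_baseChange ofRat conj_ofRat)

universe u

variable {V : Type u} [AddCommGroup V] [Module ℚ V]

/-! ## §1 Real vectors of `W_m ∩ F^a`, `2a > m`, vanish (any mixed Hodge structure) -/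

namespace Motives.MixedHodgeStructure

variable (M : MixedHodgeStructure V)

/-- **One step down**: for a mixed Hodge structure `(W, F)`, a vector `x ∈ W_{m,ℂ} ∩ F^a` with `x̄ ∈ F^a` and `2a > m` lies in
`W_{m−1,ℂ}` — on the pure `Gr^W_m` (weight `m`), `F^a Gr ∩ conj F^{m+1−a} Gr = 0` and `F^a ⊆ F^{m+1−a}` (the opposedness axiom in
the lattice form `grOpposed`). [cite: DeligneHodgeII1971, 2.3.1 and Thm. 2.3.5] [cite: CattaniDeligneKaplan1995, proof of Lemma 4.5 (i) (p. 502)] -/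
theorem mem_baseChange_W_sub_one_of_mem_F_of_conj_mem_F {m a : ℤ} (hma : m < a + a) {x : ℂ ⊗[ℚ] V}
    (hW : x ∈ (M.W m).baseChange ℂ) (hF : x ∈ M.F a) (hcF : conj x ∈ M.F a) : x ∈ (M.W (m - 1)).baseChange ℂ := by
  have h := (M.grOpposed m a (m + 1 - a) (by omega)).1
  have hle : M.F a ≤ M.F (m + 1 - a) := M.antitone_F (by omega)
  have hx1 : x ∈ (M.F a ⊓ (M.W m).baseChange ℂ) ⊔ (M.W (m - 1)).baseChange ℂ := Submodule.mem_sup_left ⟨hF, hW⟩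
  have hx2 : x ∈ (complexConj (M.F (m + 1 - a)) ⊓ (M.W m).baseChange ℂ) ⊔ (M.W (m - 1)).baseChange ℂ :=
    Submodule.mem_sup_left ⟨mem_complexConj.2 (hle hcF), hW⟩
  rw [← h]
  exact ⟨hx1, hx2⟩

/-- **Real vectors of `W_m ∩ F^a` with `2a > m` vanish**: `x ∈ W_{m,ℂ} ∩ F^a`, `x̄ ∈ F^a`, `m < 2a` ⟹ `x = 0` (descend
`W_m → W_{m−1} → … → W_b = 0`).  The rational case is the tree's `eq_zero_of_mem_W_of_lt`; CDK: «this intersection can be nonzero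
only for `w + l₁ ≥ 0`». [cite: DeligneHodgeII1971, Thm. 2.3.5] [cite: CattaniDeligneKaplan1995, proof of Lemma 4.5 (i) (p. 502) and Prop. 4.8 (p. 505)] -/
theorem eq_zero_of_mem_baseChange_W_of_mem_F_of_conj_mem_F {m a : ℤ} (hma : m < a + a) {x : ℂ ⊗[ℚ] V}
    (hW : x ∈ (M.W m).baseChange ℂ) (hF : x ∈ M.F a) (hcF : conj x ∈ M.F a) : x = 0 := by
  obtain ⟨b, hb⟩ := M.exists_W_eq_bot
  suffices key : ∀ (n : ℕ) (m : ℤ), m ≤ b + n → m < a + a → x ∈ (M.W m).baseChange ℂ → x = 0 by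
    rcases le_or_gt m b with hmb | hmb
    · exact key 0 m (by simpa using hmb) hma hW
    · exact key (m - b).toNat m (by omega) hma hW
  intro n
  induction n with
  | zero =>
    intro m hmb _ hx
    have h : x ∈ (M.W b).baseChange ℂ := Submodule.baseChange_mono ℂ (M.monotone_W (by simpa using hmb)) hx
    rwa [hb, Submodule.baseChange_bot, Submodule.mem_bot] at h
  | succ n ih =>
    intro m hmb hma' hx
    exact ih (m - 1) (by omega) (by omega) (M.mem_baseChange_W_sub_one_of_mem_F_of_conj_mem_F hma' hx hF hcF)

/-- Real form: a REAL `x` (`x̄ = x`) in `W_{m,ℂ} ∩ F^a` with `m < 2a` is zero. [cite: DeligneHodgeII1971, Thm. 2.3.5]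
[cite: CattaniDeligneKaplan1995, proof of Lemma 4.5 (i) (p. 502)] -/
theorem eq_zero_of_conj_eq_of_mem_baseChange_W_of_mem_F {m a : ℤ} (hma : m < a + a) {x : ℂ ⊗[ℚ] V} (hreal : conj x = x)
    (hW : x ∈ (M.W m).baseChange ℂ) (hF : x ∈ M.F a) : x = 0 :=
  M.eq_zero_of_mem_baseChange_W_of_mem_F_of_conj_mem_F hma hW hF (hreal.symm ▸ hF)

/-- A real `x ∈ W_{m,ℂ}` with `x ∈ F^p` and `x̄ ∈ F^q`, `m < p + q`, vanishes (`x, x̄ ∈ F^{max p q}` and `2 max ≥ p + q`).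
[cite: DeligneHodgeII1971, Thm. 2.3.5] [cite: CattaniDeligneKaplan1995, proof of Lemma 4.5 (i) (p. 502)] -/
theorem eq_zero_of_conj_eq_of_mem_baseChange_W_of_mem_F_of_conj_mem_F {m p q : ℤ} (hm : m < p + q) {x : ℂ ⊗[ℚ] V}
    (hreal : conj x = x) (hW : x ∈ (M.W m).baseChange ℂ) (hp : x ∈ M.F p) (hq : conj x ∈ M.F q) : x = 0 := by
  rw [hreal] at hq
  rcases le_total p q with hpq | hpq
  · exact M.eq_zero_of_conj_eq_of_mem_baseChange_W_of_mem_F (show m < q + q by omega) hreal hW hq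
  · exact M.eq_zero_of_conj_eq_of_mem_baseChange_W_of_mem_F (show m < p + p by omega) hreal hW hp

end Motives.MixedHodgeStructure

/-! ## §1′ The grading and `N`: `π_m ∘ N = N ∘ π_{m+2}`, and `ker N_ℂ ⊆ W_{k,ℂ}` -/

namespace HodgeTheory

namespace LimitMixedHodgeStructure

variable [FiniteDimensional ℚ V] {k : ℤ} (L : LimitMixedHodgeStructure V k)

/-- The total weights `p + q` of the nonzero `I^{p,q}` lie in a finite set. [folklore] -/
private theorem exists_weights_subset :
    ∃ s : Finset ℤ, ∀ p q : ℤ, L.toMixedHodgeStructure.deligneI p q ≠ ⊥ → p + q ∈ s := by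
  classical
  refine ⟨L.toMixedHodgeStructure.finite_setOf_deligneFamily_ne_bot.toFinset.image fun pq => pq.1 + pq.2,
    fun p q h => Finset.mem_image.2 ⟨(p, q), ?_, rfl⟩⟩
  rw [Set.Finite.mem_toFinset, Set.mem_setOf_eq, deligneFamily_apply]
  exact h

/-- `π_m x = 0` for a weight `m` outside any finite set carrying the nonzero `I^{p,q}`. [folklore] -/
private theorem deligneEProj_apply_eq_zero_of_not_mem {s : Finset ℤ}
    (hs : ∀ p q : ℤ, L.toMixedHodgeStructure.deligneI p q ≠ ⊥ → p + q ∈ s) {m : ℤ} (hm : m ∉ s) (x : ℂ ⊗[ℚ] V) :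
    L.toMixedHodgeStructure.deligneEProj m x = 0 := by
  conv_lhs => rw [← L.toMixedHodgeStructure.sum_deligneEProj_apply s hs x]
  rw [map_sum]
  refine Finset.sum_eq_zero fun m' hm' => ?_
  rw [L.toMixedHodgeStructure.deligneEProj_deligneEProj_apply]
  exact if_neg fun h : m' = m => hm (h ▸ hm')

/-- **`π_m (N x) = N (π_{m+2} x)`**: the monodromy logarithm lowers the Deligne grading by `2` (`N E_m ⊆ E_{m−2}`), so it
intertwines the projections. [cite: CattaniElZeinGriffithsLe2014, §7.5 (7.5.13) ("N V_ℓ ⊂ V_{ℓ−2}")] -/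
theorem deligneEProj_N_baseChange_apply (m : ℤ) (x : ℂ ⊗[ℚ] V) :
    L.toMixedHodgeStructure.deligneEProj m (L.N.baseChange ℂ x) =
      L.N.baseChange ℂ (L.toMixedHodgeStructure.deligneEProj (m + 2) x) := by
  classical
  obtain ⟨s, hs⟩ := L.exists_weights_subset
  have hterm : ∀ m' : ℤ, L.N.baseChange ℂ (L.toMixedHodgeStructure.deligneEProj m' x) ∈ L.toMixedHodgeStructure.deligneE (m' - 2) :=
    fun m' => L.N_baseChange_apply_mem_deligneE (L.toMixedHodgeStructure.deligneEProj_apply_mem m' x)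
  conv_lhs => rw [← L.toMixedHodgeStructure.sum_deligneEProj_apply s hs x]
  rw [map_sum, map_sum]
  by_cases hm : m + 2 ∈ s
  · rw [Finset.sum_eq_single_of_mem (m + 2) hm fun m' _ hne =>
      L.toMixedHodgeStructure.deligneEProj_apply_of_mem_deligneE_of_ne (show m' - 2 ≠ m by omega) (hterm m')]
    refine L.toMixedHodgeStructure.deligneEProj_apply_of_mem_deligneE ?_
    have h := hterm (m + 2)
    rwa [show m + 2 - 2 = m by ring] at h
  · rw [L.deligneEProj_apply_eq_zero_of_not_mem hs hm x, map_zero]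
    exact Finset.sum_eq_zero fun m' hm' =>
      L.toMixedHodgeStructure.deligneEProj_apply_of_mem_deligneE_of_ne (fun h => hm (by rw [← h, sub_add_cancel]; exact hm'))
        (hterm m')

/-- **`ker N_ℂ ⊆ W_{k,ℂ}`** (complex form of `ker N ⊆ W_k`, Morrison §3 Cor. 1): if `N x = 0` then every component `π_m x` with
`m > k` is a lowest-weight vector of positive `H`-weight of the `𝔰𝔩₂`-module, hence `0` (injectivity of `N^{m−k}` on `E_m`, the
tree's `eq_zero_of_mem_degreeSpace_of_pow_N_eq_zero`). [cite: CattaniElZeinGriffithsLe2014, Thm. 5.3.5 and §7.5 p. 307] -/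
theorem mem_baseChange_W_of_N_baseChange_apply_eq_zero {x : ℂ ⊗[ℚ] V} (hN : L.N.baseChange ℂ x = 0) :
    x ∈ (L.W k).baseChange ℂ := by
  classical
  obtain ⟨s, hs⟩ := L.exists_weights_subset
  refine L.toMixedHodgeStructure.mem_baseChange_W_of_forall_deligneEProj_eq_zero s hs fun m _ hkm => ?_
  obtain ⟨n, hn⟩ : ∃ n : ℕ, m = k + (n + 1 : ℕ) := ⟨(m - k - 1).toNat, by omega⟩
  have hmem : L.toMixedHodgeStructure.deligneEProj m x ∈ Literature.Algebra.Lie.degreeSpace (-L.deligneH) (-((n + 1 : ℕ) : ℤ)) := by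
    rw [L.degreeSpace_neg_deligneH_eq, ← deligneE_eq_biSup_mem, show k - -((n + 1 : ℕ) : ℤ) = m by omega]
    exact L.toMixedHodgeStructure.deligneEProj_apply_mem m x
  refine L.eq_zero_of_mem_degreeSpace_of_pow_N_eq_zero hmem ?_
  have hNπ : L.N.baseChange ℂ (L.toMixedHodgeStructure.deligneEProj m x) = 0 := by
    rw [show m = (m - 2) + 2 by ring, ← L.deligneEProj_N_baseChange_apply, hN, map_zero]
  rw [pow_succ, Module.End.mul_apply, hNπ, map_zero]

end LimitMixedHodgeStructure

end HodgeTheory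

/-! ## §2 Along the nilpotent orbit `θ(z) = exp(zN)·F`: `(W, θ(z))` is a mixed Hodge structure for every `z` -/

namespace HodgeTheory

namespace PolarizedLimitMixedHodgeStructure

variable [FiniteDimensional ℚ V] {k : ℤ} (L : PolarizedLimitMixedHodgeStructure V k)

/-- **Real vectors of `W_{m,ℂ} ∩ exp(zN)·F^a`, `2a > m`, vanish, for every `z ∈ ℂ`** (`(W, exp(zN)F)` is the mixed Hodge
structure `L.expTwist z`). [cite: CattaniElZeinGriffithsLe2014, §7.5 (7.5.8)] [cite: CattaniDeligneKaplan1995, proof of Lemma 4.5 (i) (p. 502)] -/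
theorem eq_zero_of_conj_eq_of_mem_baseChange_W_of_mem_map_exp_F (z : ℂ) {m a : ℤ} (hma : m < a + a) {x : ℂ ⊗[ℚ] V}
    (hreal : conj x = x) (hW : x ∈ (L.W m).baseChange ℂ) (hF : x ∈ (L.F a).map (IsNilpotent.exp (z • L.N.baseChange ℂ))) :
    x = 0 :=
  (L.expTwist z).toMixedHodgeStructure.eq_zero_of_conj_eq_of_mem_baseChange_W_of_mem_F hma hreal hW
    (by rw [show (L.expTwist z).toMixedHodgeStructure.F a = (L.expTwist z).F a from rfl, L.expTwist_F]; exact hF)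

/-- **A real vector of `W_{m,ℂ} ∩ F^aθ(z)` with `2a > m` vanishes** (`θ(z)` the nilpotent orbit, `Im z > α`).
[cite: CattaniDeligneKaplan1995, proof of Lemma 4.5 (i) (p. 502)] [cite: CattaniElZeinGriffithsLe2014, §7.5 Thm. 7.5.11 (3)] -/
theorem eq_zero_of_conj_eq_of_mem_baseChange_W_of_mem_nilpotentOrbit_F {z : ℂ} (hz : L.orbitThreshold < z.im) {m a : ℤ}
    (hma : m < a + a) {x : ℂ ⊗[ℚ] V} (hreal : conj x = x) (hW : x ∈ (L.W m).baseChange ℂ)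
    (hF : x ∈ (L.nilpotentOrbit z hz).F a) : x = 0 :=
  L.eq_zero_of_conj_eq_of_mem_baseChange_W_of_mem_map_exp_F z hma hreal hW (by rwa [L.nilpotentOrbit_F] at hF)

/-- **CDK Lemma 4.5 (i) / 4.3 at `d = 1`, exact case: a REAL class of weight `≤ k − 1` cannot be of type `(p, k−p)` at a point
of the orbit** — `x̄ = x`, `x ∈ W_{k−1,ℂ}`, `x ∈ H^{p,k−p}(θ(z))` ⟹ `x = 0` (`x, x̄ ∈ F^{max(p,k−p)}θ(z)` and `2 max ≥ k > k − 1`).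
[cite: CattaniDeligneKaplan1995, Lemma 4.4, Lemma 4.5 (i) and proof of Prop. 4.3 (pp. 501–503)] -/
theorem eq_zero_of_conj_eq_of_mem_baseChange_W_pred_of_mem_nilpotentOrbit_piece {z : ℂ} (hz : L.orbitThreshold < z.im)
    {p : ℤ} {x : ℂ ⊗[ℚ] V} (hreal : conj x = x) (hW : x ∈ (L.W (k - 1)).baseChange ℂ)
    (hx : x ∈ (L.nilpotentOrbit z hz).piece p (k - p)) : x = 0 := by
  rw [(L.nilpotentOrbit z hz).mem_piece_iff (show p + (k - p) = k by omega)] at hx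
  exact (L.expTwist z).toMixedHodgeStructure.eq_zero_of_conj_eq_of_mem_baseChange_W_of_mem_F_of_conj_mem_F
    (show k - 1 < p + (k - p) by omega) hreal hW
    (by rw [show (L.expTwist z).toMixedHodgeStructure.F p = (L.expTwist z).F p from rfl, ← L.nilpotentOrbit_F_eq_expTwist_F z hz]
        exact hx.1)
    (by rw [show (L.expTwist z).toMixedHodgeStructure.F (k - p) = (L.expTwist z).F (k - p) from rfl,
          ← L.nilpotentOrbit_F_eq_expTwist_F z hz]
        exact hx.2)

/-- Equivalently: a NONZERO real class of type `(p, k−p)` at `θ(z)` lying in `W_{k,ℂ}` has nonzero top component `π̂_k x ≠ 0`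
(`x − π̂_k x ∈ W_{k−1,ℂ}`). [cite: CattaniDeligneKaplan1995, proof of Prop. 4.3 (p. 503)] -/
theorem deligneEProj_apply_ne_zero_of_conj_eq_of_mem_nilpotentOrbit_piece {z : ℂ} (hz : L.orbitThreshold < z.im) {p : ℤ}
    {x : ℂ ⊗[ℚ] V} (hreal : conj x = x) (hW : x ∈ (L.W k).baseChange ℂ) (hx : x ∈ (L.nilpotentOrbit z hz).piece p (k - p))
    (hx0 : x ≠ 0) : L.deltaSplit.toMixedHodgeStructure.deligneEProj k x ≠ 0 := by
  intro h0
  have h := L.deltaSplit.toMixedHodgeStructure.sub_deligneEProj_apply_mem_baseChange_W hW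
  rw [h0, sub_zero] at h
  exact hx0 (L.eq_zero_of_conj_eq_of_mem_baseChange_W_pred_of_mem_nilpotentOrbit_piece hz hreal h hx)

/-- `N_ℂ` of a real vector is real. [folklore] -/
private theorem conj_N_baseChange_apply_of_conj_eq {x : ℂ ⊗[ℚ] V} (hreal : conj x = x) :
    conj (L.N.baseChange ℂ x) = L.N.baseChange ℂ x := by
  rw [conj_baseChange, hreal]

/-- **CDK Prop. 4.8 at `d = 1`, exact case: if `x` is real, of type `(p, k−p)` at `θ(z)`, and `N x ∈ W_{k−3,ℂ}`, then `N x = 0`**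
— `N x` is real, lies in `F^{p−1}θ(z)` and in `conj F^{k−p−1}θ(z)` (horizontality `N θ^a ⊆ θ^{a−1}`), and `k − 3 < (p−1) + (k−p−1)`;
«`W¹₋₃ ∩ F̃⁻¹ ∩ \bar F̃⁻¹ = 0`, so that `T₁u(n)` must be» zero. [cite: CattaniDeligneKaplan1995, Prop. 4.8 (p. 505)] -/
theorem N_apply_eq_zero_of_conj_eq_of_mem_nilpotentOrbit_piece_of_N_apply_mem_baseChange_W {z : ℂ}
    (hz : L.orbitThreshold < z.im) {p : ℤ} {x : ℂ ⊗[ℚ] V} (hreal : conj x = x)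
    (hx : x ∈ (L.nilpotentOrbit z hz).piece p (k - p)) (hN : L.N.baseChange ℂ x ∈ (L.W (k - 3)).baseChange ℂ) :
    L.N.baseChange ℂ x = 0 := by
  rw [(L.nilpotentOrbit z hz).mem_piece_iff (show p + (k - p) = k by omega)] at hx
  have hNreal := L.conj_N_baseChange_apply_of_conj_eq hreal
  have h1 : L.N.baseChange ℂ x ∈ (L.nilpotentOrbit z hz).F (p - 1) := L.map_N_nilpotentOrbit_F_le z hz p ⟨x, hx.1, rfl⟩
  have h2 : conj (L.N.baseChange ℂ x) ∈ (L.nilpotentOrbit z hz).F (k - p - 1) := by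
    rw [conj_baseChange, hreal]
    have h := L.map_N_nilpotentOrbit_F_le z hz (k - p) ⟨conj x, hx.2, rfl⟩
    rwa [hreal] at h
  exact (L.expTwist z).toMixedHodgeStructure.eq_zero_of_conj_eq_of_mem_baseChange_W_of_mem_F_of_conj_mem_F
    (show k - 3 < (p - 1) + (k - p - 1) by omega) hNreal hN
    (by rw [show (L.expTwist z).toMixedHodgeStructure.F (p - 1) = (L.expTwist z).F (p - 1) from rfl,
          ← L.nilpotentOrbit_F_eq_expTwist_F z hz]
        exact h1)
    (by rw [show (L.expTwist z).toMixedHodgeStructure.F (k - p - 1) = (L.expTwist z).F (k - p - 1) from rfl,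
          ← L.nilpotentOrbit_F_eq_expTwist_F z hz]
        exact h2)

/-- **From the top component to `N x ∈ W_{k−3}`**: if `x ∈ W_{k,ℂ}` and the weight-`k` component `π̂_k x` of the `δ`-grading is
killed by `N`, then `N x ∈ W_{k−3,ℂ}` (`x − π̂_k x ∈ W_{k−1,ℂ}` and `N W_{k−1} ⊆ W_{k−3}`) — the output form of CDK Prop. 4.7
(«`u¹` is in the kernel of `T₁ : Gr₀^{W¹} → Gr₋₂^{W¹}`»). [cite: CattaniDeligneKaplan1995, Prop. 4.7 and (4.6.1) (p. 503)] -/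
theorem N_apply_mem_baseChange_W_sub_three_of_N_deligneEProj_eq_zero {x : ℂ ⊗[ℚ] V} (hW : x ∈ (L.W k).baseChange ℂ)
    (hN : L.N.baseChange ℂ (L.deltaSplit.toMixedHodgeStructure.deligneEProj k x) = 0) :
    L.N.baseChange ℂ x ∈ (L.W (k - 3)).baseChange ℂ := by
  have h := L.deltaSplit.toMixedHodgeStructure.sub_deligneEProj_apply_mem_baseChange_W hW
  have hN' := L.toLimitMixedHodgeStructure.N_baseChange_apply_mem_baseChange_W h
  rw [map_sub, hN, sub_zero, show k - 1 - 2 = k - 3 by ring] at hN'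
  exact hN'

/-- **CDK 4.7 + 4.8 at `d = 1`, exact case: a REAL class of type `(p, k−p)` at some `θ(z)`, lying in `W_{k,ℂ}`, whose top
component `π̂_k x` is `N`-invariant, is itself `N`-invariant: `N x = 0`.** [cite: CattaniDeligneKaplan1995, Prop. 4.7, Prop. 4.8, 4.9 (pp. 503–505)] -/
theorem N_apply_eq_zero_of_conj_eq_of_mem_nilpotentOrbit_piece_of_N_deligneEProj_eq_zero {z : ℂ} (hz : L.orbitThreshold < z.im)
    {p : ℤ} {x : ℂ ⊗[ℚ] V} (hreal : conj x = x) (hW : x ∈ (L.W k).baseChange ℂ)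
    (hx : x ∈ (L.nilpotentOrbit z hz).piece p (k - p))
    (hN : L.N.baseChange ℂ (L.deltaSplit.toMixedHodgeStructure.deligneEProj k x) = 0) : L.N.baseChange ℂ x = 0 :=
  L.N_apply_eq_zero_of_conj_eq_of_mem_nilpotentOrbit_piece_of_N_apply_mem_baseChange_W hz hreal hx
    (L.N_apply_mem_baseChange_W_sub_three_of_N_deligneEProj_eq_zero hW hN)

/-! ## §3 `N`-invariant vectors: Hodge at one point ⟺ Hodge at every point ⟺ in `F^p ∩ conj F^q` of the limit -/

/-- `exp(zN_ℂ) x = x` when `N_ℂ x = 0`. [folklore] -/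
private theorem exp_smul_N_apply_eq_self_of_N_apply_eq_zero (z : ℂ) {x : ℂ ⊗[ℚ] V} (hN : L.N.baseChange ℂ x = 0) :
    IsNilpotent.exp (z • L.N.baseChange ℂ) x = x := by
  obtain ⟨n, hn⟩ := L.isNilpotent_N_baseChange
  have hT1 : L.N.baseChange ℂ ^ (n + 1) = 0 := by rw [pow_succ, hn, zero_mul]
  have hn' : (z • L.N.baseChange ℂ) ^ (n + 1) = 0 := by rw [smul_pow, hT1, smul_zero]
  rw [IsNilpotent.exp_eq_sum hn', LinearMap.sum_apply, Finset.sum_range_succ', pow_zero, Nat.factorial_zero, Nat.cast_one,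
    inv_one, one_smul, Module.End.one_apply, add_eq_right]
  refine Finset.sum_eq_zero fun i _ => ?_
  rw [LinearMap.smul_apply, pow_succ, Module.End.mul_apply, LinearMap.smul_apply, hN, smul_zero, map_zero, smul_zero]

/-- **An `N`-invariant vector lies in `exp(zN)·F^a` iff it lies in `F^a`.** [cite: CattaniDeligneKaplan1995, 4.9 (p. 505) and 2.7 (2.7.2)] -/
theorem mem_map_exp_F_iff_of_N_apply_eq_zero (z : ℂ) (a : ℤ) {x : ℂ ⊗[ℚ] V} (hN : L.N.baseChange ℂ x = 0) :
    x ∈ (L.F a).map (IsNilpotent.exp (z • L.N.baseChange ℂ)) ↔ x ∈ L.F a := by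
  constructor
  · rintro ⟨y, hy, hyx⟩
    -- `y = exp(−zN) x = x`
    have e : -(z • L.N.baseChange ℂ) = (-z) • L.N.baseChange ℂ := (neg_smul _ _).symm
    have hneg : IsNilpotent.exp (-(z • L.N.baseChange ℂ)) x = x := by
      rw [e]
      exact L.exp_smul_N_apply_eq_self_of_N_apply_eq_zero (-z) hN
    have hyx' : y = x := by
      have h : IsNilpotent.exp (-(z • L.N.baseChange ℂ)) (IsNilpotent.exp (z • L.N.baseChange ℂ) y) =
          IsNilpotent.exp (-(z • L.N.baseChange ℂ)) x := by rw [hyx]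
      rwa [← Module.End.mul_apply, IsNilpotent.exp_neg_mul_exp_self (L.isNilpotent_N_baseChange.smul z), Module.End.one_apply,
        hneg] at h
    rw [← hyx']
    exact hy
  · intro hx
    exact ⟨x, hx, L.exp_smul_N_apply_eq_self_of_N_apply_eq_zero z hN⟩

/-- **An `N`-invariant vector lies in `F^aθ(z)` iff it lies in the limit `F^a`** (`θ(z)^a = exp(zN)·F^a`, `exp(zN) x = x`).
[cite: CattaniDeligneKaplan1995, 4.9 (p. 505)] -/
theorem mem_nilpotentOrbit_F_iff_of_N_apply_eq_zero {z : ℂ} (hz : L.orbitThreshold < z.im) (a : ℤ) {x : ℂ ⊗[ℚ] V}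
    (hN : L.N.baseChange ℂ x = 0) : x ∈ (L.nilpotentOrbit z hz).F a ↔ x ∈ L.F a := by
  rw [L.nilpotentOrbit_F]
  exact L.mem_map_exp_F_iff_of_N_apply_eq_zero z a hN

/-- **An `N`-invariant vector is of type `(p, q)` at `θ(z)` iff `x ∈ F^p` and `x̄ ∈ F^q` for the LIMIT Hodge filtration** (`p + q = k`;
`x̄` is `N`-invariant with `x`, `N` being real). [cite: CattaniDeligneKaplan1995, 4.9 (p. 505)] -/
theorem mem_nilpotentOrbit_piece_iff_of_N_apply_eq_zero {z : ℂ} (hz : L.orbitThreshold < z.im) {p q : ℤ} (hpq : p + q = k)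
    {x : ℂ ⊗[ℚ] V} (hN : L.N.baseChange ℂ x = 0) :
    x ∈ (L.nilpotentOrbit z hz).piece p q ↔ x ∈ L.F p ∧ conj x ∈ L.F q := by
  have hNc : L.N.baseChange ℂ (conj x) = 0 := by rw [← conj_baseChange, hN, map_zero]
  rw [(L.nilpotentOrbit z hz).mem_piece_iff hpq, L.mem_nilpotentOrbit_F_iff_of_N_apply_eq_zero hz p hN,
    L.mem_nilpotentOrbit_F_iff_of_N_apply_eq_zero hz q hNc]

/-- **Hodge at one point ⟹ Hodge at every point, for `N`-invariant vectors**: if `N x = 0` and `x ∈ H^{p,q}(θ(z))` then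
`x ∈ H^{p,q}(θ(z'))` for every `z'` beyond the threshold. [cite: CattaniDeligneKaplan1995, 4.9 (p. 505) and Lemma 2.8 (p. 489)] -/
theorem mem_nilpotentOrbit_piece_of_N_apply_eq_zero_of_mem_nilpotentOrbit_piece {z : ℂ} (hz : L.orbitThreshold < z.im) {z' : ℂ}
    (hz' : L.orbitThreshold < z'.im) {p q : ℤ} {x : ℂ ⊗[ℚ] V} (hN : L.N.baseChange ℂ x = 0)
    (hx : x ∈ (L.nilpotentOrbit z hz).piece p q) : x ∈ (L.nilpotentOrbit z' hz').piece p q := by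
  by_cases hpq : p + q = k
  · rw [L.mem_nilpotentOrbit_piece_iff_of_N_apply_eq_zero hz' hpq hN]
    exact (L.mem_nilpotentOrbit_piece_iff_of_N_apply_eq_zero hz hpq hN).1 hx
  · rw [(L.nilpotentOrbit z hz).piece_eq_bot_of_add_ne hpq] at hx
    rw [(L.nilpotentOrbit z' hz').piece_eq_bot_of_add_ne hpq]
    exact hx

/-- `ker N_ℂ ⊆ W_{k,ℂ}` for the polarized structure. [cite: CattaniElZeinGriffithsLe2014, Thm. 5.3.5] -/
theorem mem_baseChange_W_of_N_apply_eq_zero {x : ℂ ⊗[ℚ] V} (hN : L.N.baseChange ℂ x = 0) : x ∈ (L.W k).baseChange ℂ :=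
  L.toLimitMixedHodgeStructure.mem_baseChange_W_of_N_baseChange_apply_eq_zero hN

/-- **An `N`-invariant vector of type `(p, q)` at one point of the orbit is a limit Hodge class of type `(p, q)`**: it lies in
Deligne's `I^{p,q}` of the limit mixed Hodge structure `(W, F)` (`x ∈ F^p ∩ conj F^q ∩ W_{k,ℂ} ⊆ I^{p,q}`, `p + q = k`).
[cite: CattaniDeligneKaplan1995, Thm. 2.5 (ii) ("in `F_v⁰` for some limiting Hodge filtration") and 4.9 (p. 505)]
[cite: DeligneHodgeII1971, 2.3.1] -/
theorem mem_deligneI_of_N_apply_eq_zero_of_mem_nilpotentOrbit_piece {z : ℂ} (hz : L.orbitThreshold < z.im) {p q : ℤ}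
    (hpq : p + q = k) {x : ℂ ⊗[ℚ] V} (hN : L.N.baseChange ℂ x = 0) (hx : x ∈ (L.nilpotentOrbit z hz).piece p q) :
    x ∈ L.toMixedHodgeStructure.deligneI p q := by
  obtain ⟨hp, hq⟩ := (L.mem_nilpotentOrbit_piece_iff_of_N_apply_eq_zero hz hpq hN).1 hx
  refine L.toMixedHodgeStructure.F_inf_complexConj_F_inf_W_le_deligneI p q ⟨⟨hp, mem_complexConj.2 hq⟩, ?_⟩
  rw [hpq]
  exact L.mem_baseChange_W_of_N_apply_eq_zero hN

/-! ## §4 The package for the integral theorem -/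

/-- **CDK Thm. 2.5 (ii), `n = 1`, given the invariance of the top component**: a REAL class `x ∈ W_{k,ℂ}` of type `(p, k−p)` at
SOME point `θ(z)` whose weight-`k` component `π̂_k x` (the `δ`-grading) is killed by `N` satisfies: `N x = 0`; `x` is of type
`(p, k−p)` at EVERY point of the orbit; `x ∈ F^p ∩ conj F^{k−p}` and `x ∈ I^{p,k−p}` for the limit mixed Hodge structure — «any such
`v` is in `W₀`, as well as in `F_v⁰` for some limiting Hodge filtration `F_v`».  (That `π̂_k x` IS killed by `N` for integral classes
of bounded norm near the puncture is CDK Prop. 4.7, the compactness step, proved in the sequel.)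
[cite: CattaniDeligneKaplan1995, Thm. 2.5 (ii) (p. 488), Prop. 4.7–4.8, 4.9 (pp. 503–505)] -/
theorem N_apply_eq_zero_and_forall_mem_piece_of_N_deligneEProj_eq_zero {z : ℂ} (hz : L.orbitThreshold < z.im) {p : ℤ}
    {x : ℂ ⊗[ℚ] V} (hreal : conj x = x) (hW : x ∈ (L.W k).baseChange ℂ) (hx : x ∈ (L.nilpotentOrbit z hz).piece p (k - p))
    (hN : L.N.baseChange ℂ (L.deltaSplit.toMixedHodgeStructure.deligneEProj k x) = 0) :
    L.N.baseChange ℂ x = 0 ∧ (∀ (z' : ℂ) (hz' : L.orbitThreshold < z'.im), x ∈ (L.nilpotentOrbit z' hz').piece p (k - p)) ∧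
      (x ∈ L.F p ∧ conj x ∈ L.F (k - p)) ∧ x ∈ L.toMixedHodgeStructure.deligneI p (k - p) := by
  have hN0 := L.N_apply_eq_zero_of_conj_eq_of_mem_nilpotentOrbit_piece_of_N_deligneEProj_eq_zero hz hreal hW hx hN
  exact ⟨hN0, fun z' hz' => L.mem_nilpotentOrbit_piece_of_N_apply_eq_zero_of_mem_nilpotentOrbit_piece hz hz' hN0 hx,
    (L.mem_nilpotentOrbit_piece_iff_of_N_apply_eq_zero hz (show p + (k - p) = k by omega) hN0).1 hx,
    L.mem_deligneI_of_N_apply_eq_zero_of_mem_nilpotentOrbit_piece hz (show p + (k - p) = k by omega) hN0 hx⟩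

/-- **Rational form** (`x = 1 ⊗ u`, `u ∈ V`): if `u ∈ W_k` is of type `(p, k−p)` at some `θ(z)` and `N (π̂_k (1 ⊗ u)) = 0`, then
`N u = 0`, `u` is a Hodge class of type `(p, k−p)` at every point, and `1 ⊗ u ∈ F^p` — `u` is a Hodge class of the limit mixed
Hodge structure. [cite: CattaniDeligneKaplan1995, Thm. 2.5 (ii) (p. 488) and 4.9 (p. 505)] -/
theorem N_apply_eq_zero_and_forall_ofRat_mem_piece_of_N_deligneEProj_eq_zero {z : ℂ} (hz : L.orbitThreshold < z.im) {p : ℤ}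
    {u : V} (hW : u ∈ L.W k) (hu : ofRat u ∈ (L.nilpotentOrbit z hz).piece p (k - p))
    (hN : L.N.baseChange ℂ (L.deltaSplit.toMixedHodgeStructure.deligneEProj k (ofRat u)) = 0) :
    L.N u = 0 ∧ (∀ (z' : ℂ) (hz' : L.orbitThreshold < z'.im), ofRat u ∈ (L.nilpotentOrbit z' hz').piece p (k - p)) ∧
      ofRat u ∈ L.F p := by
  have hW' : ofRat u ∈ (L.W k).baseChange ℂ := by
    rw [HodgeStructure.ofRat_apply]
    exact Submodule.tmul_mem_baseChange_of_mem 1 hW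
  obtain ⟨hN0, hall, hF, -⟩ := L.N_apply_eq_zero_and_forall_mem_piece_of_N_deligneEProj_eq_zero hz (conj_ofRat u) hW' hu hN
  refine ⟨?_, hall, hF.1⟩
  rw [HodgeStructure.ofRat_apply, LinearMap.baseChange_tmul, ← HodgeStructure.ofRat_apply] at hN0
  exact HodgeStructure.ofRat_injective (hN0.trans (map_zero _).symm)

end PolarizedLimitMixedHodgeStructure

end HodgeTheory

end Literature.AlgebraicGeometry

end
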